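import Summits.HodgeConjecture.HodgeCM.Model.FacePeriodR2J_1

/-! PORT of `HodgeCM/Model/FacePeriodR2J.lean` (HodgeCMPerL run 82) — part 2: continuation of `Summits.HodgeConjecture.HodgeCM.Model.FacePeriodR2J_1` (split at a top-level declaration boundary by port_pkg.py; scope re-opened below; declarations unchanged). -/

-- port_pkg: scope re-opened for this part (file-level context, then the namespace/section stack open at the cut)
set_option autoImplicit false
noncomputable section
open scoped TensorProduct InnerProductSpace Matrix
open Literature.NumberTheory.Automorphic Literature.NumberTheory.Weil1964
open Literature.NumberTheory.GelbartRogawski1991.UnitaryDualPair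
open HodgeCM.Adelic HodgeCM.PerL34
open scoped Classical
open Literature.Geometry.ComplexHyperbolic.BallModel (U21 x₀ stabilizerEquivK21)
open Literature.NumberTheory.Automorphic.U21 (K21 matA sclD)
namespace HodgeCM
namespace Model
open NumberField NumberField.InfinitePlace
open HodgeCM.Model.ArchSideTerm
open HodgeCM.Universe (AdelicThetaCore AdelicThetaCore₀ SideData ThetaModel ModelAxiomsPerL)
open Literature.AlgebraicGeometry.HodgeTheory
open Literature.AlgebraicGeometry.ComplexMultiplication (Shimura1998_Thm3_isogenousPower Shimura1998_Thm2_Cor)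
open Literature.NumberTheory.Automorphic.PicardCM
open Literature.NumberTheory.Transcendental (Arapura2012_Cor_15_4_6)
open HodgeCM.CMTypeOps (inflate)
open HodgeCM.Model.SupplyResidual (ClassSupplyPackN)
open HodgeCM.Model.ThetaSpace
section Record
variable (hHD : exists_isReal_hodgeModel) (hI : hodgePQ_independent_of_hodgeModel)
  (h₁ : BallQuotientUniformised) (h₃ : CMAbelianVarietyEigenbasisRealised)
/-- **THE ∃(ι₁, V, σ)-FORM CONSUMED TREE-SIDE** (shape of `hc_cm_closed_of_exists_facePeriod_sigma`'s hypothesis in the stage-2 σ-socket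
`CorCM/B01/Transposition/AssemblySigma.lean`, here over the RECORD's model universe, not over the tree's `U_rec`): for every Galois CM `F` with `6 ≤ [F:ℚ]`
and every rank-four face `f` there are a surface embedding `ι₁`, a hermitian `V` and an ADMISSIBLE eigen-embedding `σ` with `U.PeriodNV ι₁ V F f.psi σ` —
`σ :=` any admissible embedding (`StubTree.admissible_exists`, rfwf Lemma 2.1), `ι₁ :=` its place representative, `V :=` Landherr's space (`StubTree.landherr_exists`).
Binder groups «JBUARM»'s two. [folklore] -/
theorem exists_periodNV_sigma_face_r20JBUARM
    (hGRU : ∀ (L : Type) [Field L] [NumberField L] [NumberField.IsCMField L] {N M n : ℕ} (e : Fin N × Fin M ≃ Fin n)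
      (dV : Fin N → L) (hdV : ∀ i, NumberField.IsCMField.complexConj L (dV i) = dV i) (hdV0 : ∀ i, dV i ≠ 0)
      (dW : Fin M → L) (hdW : ∀ i, NumberField.IsCMField.complexConj L (dW i) = dW i) (hdW0 : ∀ i, dW i ≠ 0),
      (cmSplittingDatum L e dV hdV hdV0 dW hdW hdW0).CompatibleSplitting)
    (h418 : ∀ {L : CMField} {ι₁ : L →+* ℂ} (V : HermSpace3 L ι₁), (NumberField.InfinitePlace.mk ι₁).embedding = ι₁ → ∀ a₀ : LiuIndex.RealScalar L,
      (liuDictionaryPin hHD hI h₁ (cmAbelianVarietyRealised_of_eigenbasis hHD hI h₃) Literature.NumberTheory.Transcendental.arapura2012_cor_15_4_6_holds V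
          (LiuIndex.I V (LiuIndex.repAt a₀) (LiuIndex.muLiu ι₁ LiuIndex.GramClass.rep))
          (LiuIndex.line V (LiuIndex.repAt a₀) (LiuIndex.muLiu ι₁ LiuIndex.GramClass.rep))).Thm418C) :
    ∀ (F : CMField), IsGalois ℚ F → 6 ≤ Module.finrank ℚ F → ∀ (f : Face F),
      ∃ (ι₁ : F →+* ℂ) (V : HermSpace3 F ι₁) (σ : F →+* ℂ), f.Admissible σ ∧ (picardCMUniverse hHD hI h₁ (cmAbelianVarietyRealised_of_eigenbasis hHD hI h₃)).PeriodNV ι₁ V F f.psi σ :=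
  fun F hG h6 f => by
    haveI := hG
    obtain ⟨σ, hσ⟩ := StubTree.admissible_exists F h6 f
    obtain ⟨V⟩ := StubTree.landherr_exists F (NumberField.InfinitePlace.mk σ).embedding
    exact ⟨_, V, σ, hσ, periodNV_face_repr_R2J hHD hI h₁ (cmAbelianVarietyRealised_of_eigenbasis hHD hI h₃) Literature.NumberTheory.Transcendental.arapura2012_cor_15_4_6_holds
      (@SInstance.GRU.hGR hGRU) (@SInstance.GRU.hGR₀ hGRU) (@SInstance.GRU.hGR₁ hGRU) (@SInstance.GRU.hGR₂ hGRU) (@SInstance.GRU.hGR₃ hGRU) @ArchSideTerm.muSlotZero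
      Literature.AlgebraicGeometry.HodgeTheory.deligneMilne1982_Thm_6_20_full_holds F h6 f hσ V (h418 V (by rw [NumberField.InfinitePlace.mk_embedding]))⟩

end Record

end Model

end HodgeCM

end
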